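import Summits.QuantumFields.YangMills.Theorems.LuscherReductionDressedRitzOfExcitedPlateau
import Summits.QuantumFields.YangMills.Theorems.LuscherReductionRunningReductionKTPhysSpace
import Summits.QuantumFields.YangMills.Theorems.LuscherReductionRunningReductionExplicitNoIntruderCostume
import HarnessLib

/-!
# Route `LuscherReduction`, item `DressedRitz` (stmt-QuantumFields-20205) — reduction chain, file 4: the cut in OPERATOR LANGUAGE —
# `OperatorPlateauAt k → OrthoPlateauAt k → ExcitedPlateauAt k → DressedRitzAt k`, and the route decl from `∀ k, OperatorPlateauAt k`

Support module of the `FemtoTransferGap` group (fleet service by seat ym-infvol-p2 g6; route `LuscherReduction`, femto rung R2b1; bears on the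
crux child `DressedRitz` = stmt-QuantumFields-20205 of RED stmt-QuantumFields-19978).  CONTENT = §0, §1, §3 of the planner's crux workfile
`Summits/QuantumFields/YangMills/Cruxes/RunningReduction/Lines/OperatorPlateau.lean` (rev 2, seat ym-cruxidea-19978-1 GEN 6; kernel-checked there,
farm rc 0) RE-HOMED on the Theorems side LEVEL BY LEVEL (cuts ↦ their `k`-slices `OpPlat.OrthoPlateauAt k`, `OpPlat.OperatorPlateauAt k`,
`KTGen.ExcitedPlateauAt k` and the objects `OpPlat.ins`, `OpPlat.PlateauClauses` of `…DressedRitzPlateauDefs.lean`; proofs VERBATIM minus the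
leading `intro k`).

WHAT CHANGES FOR THE PROVER.  `ExcitedPlateauAt k` asks for `k` physical UNIT vectors `w_i` with Hilbert-space clauses (x1)–(x7).  The natural
witnesses are `w_i = u_i/‖u_i‖` with `u_i ⟂ Ω` EXACTLY — e.g. `u_i = (O_i − ⟨O_i⟩_Ω)·Ω` for gauge-invariant zero-flux INSERTIONS `O_i` (smeared ∕
flowed loop functionals) and the vacuum `Ω`.  `OrthoPlateauAt k` is `ExcitedPlateauAt k` rewritten HOMOGENEOUSLY in un-normalised vectors `u_i ⟂ φ`
(clauses `PlateauClauses` (o0)–(o7): every quantity is one of the five vacuum-sector numbers `n_i = ‖u_i‖²`, `⟨u_i,u_l⟩`, `d_il = ⟨u_i, K_β u_l⟩`,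
`‖K_β u_i‖² = ⟨u_i, K_β² u_i⟩`), and `OperatorPlateauAt k` is the same with `u_i := ins φ O_i` produced from insertions.  Every normalisation, the
Rayleigh quotients, the residual identity `‖Kw − ⟨w,Kw⟩w‖² = (‖Ku‖²‖u‖² − ⟨u,Ku⟩²)/‖u‖⁴` and clause (x3) (EXACT: `⟨φ, u_i⟩ = 0`) are discharged here
once.  What is left to the prover of item 20205 is the RG estimate of the slab expectations behind these numbers in the femto window, uniformly in the
slab length — the XL content.

* §0 raw helpers (`isPhys_mul/sub/div`, `l2_smul_smul`, `qform_smul_smul`; `l2_smul_right` is the tree's, `…ExplicitNoIntruderCostume`); §1 `ins_eq`, `ins_div`, `isPhys_ins`,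
  `l2_vac_ins : ⟨φ, ins φ O⟩ = 0` (`‖φ‖ = 1`).
* §3 `residual_normSq`; ★★ `excitedPlateauAt_of_orthoPlateauAt`; `orthoPlateauAt_of_operatorPlateauAt`; ★★ `excitedPlateauAt_of_operatorPlateauAt`;
  `dressedRitzAt_of_orthoPlateauAt`, ★ `dressedRitzAt_of_operatorPlateauAt : OperatorPlateauAt k → DressedRitzAt k`.
* §4 ★★ `dressedRitz_of_operatorPlateau : (∀ k, OperatorPlateauAt k) → Theses.LuscherReduction.DressedRitz` (item 20205 BY NAME) and
  `dressedRitz_of_orthoPlateau`.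
Non-vacuity (`RunningReduction → ∀ k, OperatorPlateauAt k`): companion file `…DressedRitzPlateauCertificates.lean`.

HONEST FRAMING: fixed-lattice linear algebra on the femto rung R2b1; it re-expresses item 20205's typed cut in the variables a constructive-QFT prover
controls, proves no estimate, and has no bearing on infinite volume, the continuum limit or the Clay mass gap.  References: M. Lüscher, NPB 219
(1983) 233 [cite: Luscher1983, §3]; Lüscher–Wolff, NPB 339 (1990) 222 (GEVP ∕ operator bases) [cite: LuscherWolff1990]; Reed–Simon IV, Thm. XIII.1
[cite: ReedSimonIV1978, Thm. XIII.1].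
-/

set_option autoImplicit false

noncomputable section

open MeasureTheory Filter Topology Real
open Literature.MathematicalPhysics.QuantumFieldTheory
open Literature.MathematicalPhysics.QuantumLattice
open Literature.Analysis.OperatorTheory.YMMatrixModel
open scoped BigOperators

namespace Summit.QuantumFields.YangMills.Theorems.FemtoTransferGap.OpPlat

open Summit.QuantumFields.YangMills.Theorems.FemtoTransferGap
open Summit.QuantumFields.YangMills.Theorems.FemtoTransferGap.KTRCalibration
open Summit.QuantumFields.YangMills.Theorems.FemtoTransferGap.PhysL2
open Summit.QuantumFields.YangMills.Theorems.FemtoTransferGap.KTGen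

/-! ## §0 Raw helpers -/

section Raw
variable {L : ℕ}

/-- Products of physical zero-flux test functions are physical. [folklore] -/
theorem isPhys_mul {ψ φ : GaugeConfig 3 L SU2 → ℝ} (hψ : IsPhys ψ) (hφ : IsPhys φ) : IsPhys (ψ * φ) where
  measurable := hψ.measurable.mul hφ.measurable
  bounded := by
    obtain ⟨C, hC⟩ := hψ.bounded
    obtain ⟨D, hD⟩ := hφ.bounded
    exact ⟨C * D, fun U => by
      rw [Pi.mul_apply, abs_mul]
      exact mul_le_mul (hC U) (hD U) (abs_nonneg _) ((abs_nonneg _).trans (hC U))⟩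
  gaugeInv := fun g U => by simp only [Pi.mul_apply, hψ.gaugeInv g U, hφ.gaugeInv g U]
  zeroFlux := fun k z hz U => by simp only [Pi.mul_apply, hψ.zeroFlux k z hz U, hφ.zeroFlux k z hz U]

/-- Differences of physical zero-flux test functions are physical. [folklore] -/
theorem isPhys_sub {ψ φ : GaugeConfig 3 L SU2 → ℝ} (hψ : IsPhys ψ) (hφ : IsPhys φ) : IsPhys (ψ - φ) where
  measurable := hψ.measurable.sub hφ.measurable
  bounded := by
    obtain ⟨C, hC⟩ := hψ.bounded
    obtain ⟨D, hD⟩ := hφ.bounded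
    exact ⟨C + D, fun U => by
      rw [Pi.sub_apply]
      have h := abs_sub_le (ψ U) 0 (φ U)
      rw [sub_zero, zero_sub, abs_neg] at h
      exact h.trans (add_le_add (hC U) (hD U))⟩
  gaugeInv := fun g U => by simp only [Pi.sub_apply, hψ.gaugeInv g U, hφ.gaugeInv g U]
  zeroFlux := fun k z hz U => by simp only [Pi.sub_apply, hψ.zeroFlux k z hz U, hφ.zeroFlux k z hz U]

/-- The quotient `ψ/Ω` of a physical test function by a physical function bounded BELOW by `c > 0` (the Perron–Frobenius vacuum,
`PhysL2.exists_groundState`) is physical. [folklore] -/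
theorem isPhys_div {ψ Ω : GaugeConfig 3 L SU2 → ℝ} (hψ : IsPhys ψ) (hΩ : IsPhys Ω) {c : ℝ} (hc : 0 < c) (hcle : ∀ U, c ≤ Ω U) :
    IsPhys (ψ / Ω) where
  measurable := hψ.measurable.div hΩ.measurable
  bounded := by
    obtain ⟨B, hB⟩ := hψ.bounded
    refine ⟨B / c, fun U => ?_⟩
    have hΩU : c ≤ Ω U := hcle U
    have hΩpos : 0 < Ω U := hc.trans_le hΩU
    have hB0 : 0 ≤ B := (abs_nonneg _).trans (hB U)
    rw [Pi.div_apply, abs_div, abs_of_pos hΩpos, div_le_iff₀ hΩpos]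
    calc |ψ U| ≤ B := hB U
      _ = B / c * c := (div_mul_cancel₀ B hc.ne').symm
      _ ≤ B / c * Ω U := mul_le_mul_of_nonneg_left hΩU (div_nonneg hB0 hc.le)
  gaugeInv := fun g U => by simp only [Pi.div_apply, hψ.gaugeInv g U, hΩ.gaugeInv g U]
  zeroFlux := fun k z hz U => by simp only [Pi.div_apply, hψ.zeroFlux k z hz U, hΩ.zeroFlux k z hz U]

variable [NeZero L]

/-- `⟨aψ, bφ⟩ = ab⟨ψ, φ⟩`. [folklore] -/
theorem l2_smul_smul (a b : ℝ) (ψ φ : GaugeConfig 3 L SU2 → ℝ) : l2 (a • ψ) (b • φ) = a * b * l2 ψ φ := by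
  rw [l2_smul_left, l2_comm, l2_smul_left, l2_comm]
  ring

/-- `qform(aψ, bφ) = ab·qform(ψ, φ)`. [folklore] -/
theorem qform_smul_smul (β a b : ℝ) (ψ φ : GaugeConfig 3 L SU2 → ℝ) :
    qform su2Rep β (a • ψ) (b • φ) = a * b * qform su2Rep β ψ φ := by
  rw [qform_eq_l2_transferApply, qform_eq_l2_transferApply, transferApply_smul, l2_smul_smul]

end Raw

/-! ## §1 Vacuum-subtracted insertions applied to the vacuum (`OpPlat.ins φ O = (O − ⟨φ, O·φ⟩)·φ`, defined in `…DressedRitzPlateauDefs.lean`) -/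

section Objects
variable {L : ℕ} [NeZero L]

/-- `ins φ O` is physical for physical `φ`, `O`. [folklore] -/
theorem isPhys_ins {φ O : GaugeConfig 3 L SU2 → ℝ} (hφ : IsPhys φ) (hO : IsPhys O) : IsPhys (ins φ O) :=
  isPhys_mul (isPhys_sub hO (isPhys_const _)) hφ

/-- `ins φ O = O·φ − ⟨φ, O·φ⟩•φ`. [folklore] -/
theorem ins_eq (φ O : GaugeConfig 3 L SU2 → ℝ) : ins φ O = O * φ - l2 φ (O * φ) • φ := by
  funext U
  simp only [ins, Pi.mul_apply, Pi.sub_apply, Pi.smul_apply, smul_eq_mul]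
  ring

/-- For a nowhere-vanishing vacuum, the insertion `ψ/Ω` produces `ins Ω (ψ/Ω) = ψ − ⟨Ω, ψ⟩•Ω` — every vector `⟂ Ω` is an `ins`. [folklore] -/
theorem ins_div {Ω : GaugeConfig 3 L SU2 → ℝ} (hΩ : ∀ U, Ω U ≠ 0) (ψ : GaugeConfig 3 L SU2 → ℝ) :
    ins Ω (ψ / Ω) = ψ - l2 Ω ψ • Ω := by
  have hmul : ψ / Ω * Ω = ψ := funext fun U => by
    rw [Pi.mul_apply, Pi.div_apply, div_mul_cancel₀ (ψ U) (hΩ U)]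
  rw [ins_eq, hmul]

/-- ★ Clause (x3) is EXACT for subtracted insertions: `⟨φ, ins φ O⟩ = 0` whenever `‖φ‖² = 1`. [folklore] -/
theorem l2_vac_ins {φ O : GaugeConfig 3 L SU2 → ℝ} (hφ : IsPhys φ) (hO : IsPhys O) (hφ1 : l2 φ φ = 1) : l2 φ (ins φ O) = 0 := by
  -- in the `physSubmodule` currency, where `l2Form` is bilinear with no side conditions
  set Φ : physSubmodule L := ⟨φ, hφ⟩ with hΦ
  set OΦ : physSubmodule L := ⟨O * φ, isPhys_mul hO hφ⟩ with hOΦ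
  have hins : (ins φ O) = ((OΦ - l2 φ (O * φ) • Φ : physSubmodule L) : GaugeConfig 3 L SU2 → ℝ) := by
    rw [ins_eq]; rfl
  have h : l2Form L Φ (OΦ - l2 φ (O * φ) • Φ) = 0 := by
    rw [map_sub, map_smul, smul_eq_mul, l2Form_apply, l2Form_apply]
    show l2 φ (O * φ) - l2 φ (O * φ) * l2 φ φ = 0
    rw [hφ1, mul_one, sub_self]
  rw [hins]
  exact h

end Objects

/-! ## §3 `OperatorPlateauAt k → OrthoPlateauAt k → ExcitedPlateauAt k` -/

section Reduction
variable {L : ℕ} [NeZero L]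

/-- The residual identity for `w = c•u`, `q` real: `‖K w − q•w‖² = c²(‖Ku‖² − 2q⟨u,Ku⟩ + q²‖u‖²)`. [folklore] -/
theorem residual_normSq (β : ℝ) {u : GaugeConfig 3 L SU2 → ℝ} (hu : IsPhys u) (c q : ℝ) :
    l2 (transferApply β (c • u) - q • (c • u)) (transferApply β (c • u) - q • (c • u)) =
      c ^ 2 * (l2 (transferApply β u) (transferApply β u) - 2 * q * l2 u (transferApply β u) + q ^ 2 * l2 u u) := by
  set U : physSubmodule L := ⟨u, hu⟩ with hU
  have hcoe : transferApply β (c • u) - q • (c • u) =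
      ((c • (transferOp β U - q • U) : physSubmodule L) : GaugeConfig 3 L SU2 → ℝ) := by
    rw [transferApply_smul]
    simp only [Submodule.coe_smul, Submodule.coe_sub, coe_transferOp, smul_sub, smul_smul, mul_comm q c]
    rfl
  have h : l2Form L (c • (transferOp β U - q • U)) (c • (transferOp β U - q • U)) =
      c ^ 2 * (l2Form L (transferOp β U) (transferOp β U) - 2 * q * l2Form L U (transferOp β U) + q ^ 2 * l2Form L U U) := by
    simp only [map_smul, map_sub, LinearMap.smul_apply, LinearMap.sub_apply, smul_eq_mul, transferOp_symm]
    ring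
  rw [hcoe, ← l2Form_apply, h, l2Form_apply, l2Form_apply, l2Form_apply, coe_transferOp]

omit [NeZero L] in
/-- ★★ **`OrthoPlateauAt k → ExcitedPlateauAt k`** — witnesses `w_i := (√n_i)⁻¹ • u_i`, vacuum `φ`; constants unchanged. [cite: Luscher1983] -/
theorem excitedPlateauAt_of_orthoPlateauAt {k : ℕ} (h : OrthoPlateauAt k) : ExcitedPlateauAt k := by
  obtain ⟨C, lam0, hC0, hlam0, hC⟩ := h
  refine ⟨C, lam0, hlam0, fun lam hlam hle => ?_⟩
  obtain ⟨L0, hL⟩ := hC lam hlam hle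
  refine ⟨L0, fun L _ hL0 β hW => ?_⟩
  obtain ⟨φ, hφ, hφ1, hKφ, u, hu, hperp, hn0, h1, h2, h4, h5, h6, h7⟩ := hL L hL0 β hW
  have hlam_nn : 0 ≤ luscherLambda β L := luscherLambda_nonneg β L
  -- norms, one-step correlators, normalising constants
  set n : Fin k → ℝ := fun i => l2 (u i) (u i) with hn_def
  have hn_eq : ∀ i, l2 (u i) (u i) = n i := fun i => rfl
  have hn0' : ∀ i, 0 < n i := hn0
  set d : Fin k → Fin k → ℝ := fun i l => l2 (u i) (transferApply β (u l)) with hd_def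
  have hd_eq : ∀ i l, l2 (u i) (transferApply β (u l)) = d i l := fun i l => rfl
  set c : Fin k → ℝ := fun i => (Real.sqrt (n i))⁻¹ with hc_def
  have hsq : ∀ i, 0 < Real.sqrt (n i) := fun i => Real.sqrt_pos.mpr (hn0' i)
  have hc0 : ∀ i, 0 < c i := fun i => inv_pos.mpr (hsq i)
  have hcs : ∀ i, c i * Real.sqrt (n i) = 1 := fun i => inv_mul_cancel₀ (hsq i).ne'
  have hcc : ∀ i, c i * c i * n i = 1 := fun i => by
    have hs : Real.sqrt (n i) * Real.sqrt (n i) = n i := Real.mul_self_sqrt (hn0' i).le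
    calc c i * c i * n i = c i * c i * (Real.sqrt (n i) * Real.sqrt (n i)) := by rw [hs]
      _ = (c i * Real.sqrt (n i)) * (c i * Real.sqrt (n i)) := by ring
      _ = 1 := by rw [hcs i, mul_one]
  have hcc' : ∀ i, c i * c i = 1 / n i := fun i => by
    rw [eq_div_iff (hn0' i).ne']; exact hcc i
  -- the witnesses
  set w : Fin k → (GaugeConfig 3 L SU2 → ℝ) := fun i => c i • u i with hw_def
  have hl2w : ∀ i l, l2 (w i) (w l) = c i * c l * l2 (u i) (u l) := fun i l => l2_smul_smul _ _ _ _
  have hqw : ∀ i l, qform su2Rep β (w i) (w l) = c i * c l * d i l := fun i l => by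
    rw [hw_def, qform_smul_smul, ← hd_eq, ← qform_eq_l2_transferApply]
  have hqd : ∀ i, qform su2Rep β (w i) (w i) = d i i / n i := fun i => by
    rw [hqw, hcc', one_div, ← div_eq_inv_mul]
  refine ⟨w, fun i => (hu i).smul _, fun i => ?_, fun i l hil => ?_, fun i l hil => ?_, ⟨φ, hφ, hφ1, hKφ, fun i => ?_⟩,
    fun i => ?_, fun i => ?_, fun i l hil => ?_, fun i => ?_⟩
  · -- unit norm
    rw [hl2w, hn_eq, hcc]
  · -- (x1) from (o1)
    rw [hqd, hqd, div_le_div_iff₀ (hn0' l) (hn0' i)]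
    exact h1 i l hil
  · -- (x2) from (o2)
    rw [hl2w, abs_mul, abs_mul, abs_of_pos (hc0 i), abs_of_pos (hc0 l)]
    calc c i * c l * |l2 (u i) (u l)|
        ≤ c i * c l * (C * luscherLambda β L * (Real.sqrt (n i) * Real.sqrt (n l))) :=
          mul_le_mul_of_nonneg_left (h2 i l hil) (mul_pos (hc0 i) (hc0 l)).le
      _ = C * luscherLambda β L * ((c i * Real.sqrt (n i)) * (c l * Real.sqrt (n l))) := by ring
      _ = C * luscherLambda β L := by rw [hcs, hcs, mul_one, mul_one]
  · -- (x3): exact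
    rw [hw_def]
    show |l2 φ (c i • u i)| ≤ _
    rw [l2_smul_right, hperp i, mul_zero, abs_zero]
    exact mul_nonneg hC0 hlam_nn
  · -- (x4) from (o4)
    rw [hw_def]
    show l2 (transferApply β (c i • u i) - qform su2Rep β (c i • u i) (c i • u i) • (c i • u i))
        (transferApply β (c i • u i) - qform su2Rep β (c i • u i) (c i • u i) • (c i • u i)) ≤ _
    have hq : qform su2Rep β (c i • u i) (c i • u i) = d i i / n i := hqd i
    rw [hq, residual_normSq β (hu i), hd_eq, hn_eq]
    have hkey : c i ^ 2 * (l2 (transferApply β (u i)) (transferApply β (u i)) -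
          2 * (d i i / n i) * d i i + (d i i / n i) ^ 2 * n i) =
        (l2 (transferApply β (u i)) (transferApply β (u i)) * n i - d i i ^ 2) / n i ^ 2 := by
      have hni : n i ≠ 0 := (hn0' i).ne'
      rw [sq (c i), hcc']
      field_simp
      ring
    rw [hkey, div_le_iff₀ (pow_pos (hn0' i) 2)]
    exact h4 i
  · -- (x5) from (o5)
    obtain ⟨h5a, h5b⟩ := h5 i
    refine ⟨?_, ?_⟩
    · rw [hqd, div_mul_eq_mul_div, div_le_iff₀ (hn0' i)]
      exact h5a
    · rw [hqd, div_mul_eq_mul_div, ← mul_div_assoc, le_div_iff₀ (hn0' i)]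
      exact h5b
  · -- (x6) from (o6)
    rw [hqw, hqd, hqd, hl2w]
    have hfac : c i * c l * d i l - (d i i / n i + d l l / n l) / 2 * (c i * c l * l2 (u i) (u l)) =
        (c i * c l) * (d i l - (d i i / n i + d l l / n l) / 2 * l2 (u i) (u l)) := by ring
    rw [hfac, abs_mul, abs_of_pos (mul_pos (hc0 i) (hc0 l))]
    calc c i * c l * |d i l - (d i i / n i + d l l / n l) / 2 * l2 (u i) (u l)|
        ≤ c i * c l * (C * (luscherLambda β L ^ 2 / L) * levelValue su2Rep L β 0 *
            (Real.sqrt (n i) * Real.sqrt (n l))) :=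
          mul_le_mul_of_nonneg_left (h6 i l hil) (mul_pos (hc0 i) (hc0 l)).le
      _ = C * (luscherLambda β L ^ 2 / L) * levelValue su2Rep L β 0 *
            ((c i * Real.sqrt (n i)) * (c l * Real.sqrt (n l))) := by ring
      _ = C * (luscherLambda β L ^ 2 / L) * levelValue su2Rep L β 0 := by rw [hcs, hcs, mul_one, mul_one]
  · -- (x7) from (o7)
    rw [hqd, sub_le_iff_le_add, ← sub_le_iff_le_add', le_div_iff₀ (hn0' i), sub_mul]
    have := h7 i
    linarith

omit [NeZero L] in
/-- `OperatorPlateauAt k → OrthoPlateauAt k`: the subtracted insertions are exactly orthogonal to the vacuum (`l2_vac_ins`). [folklore] -/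
theorem orthoPlateauAt_of_operatorPlateauAt {k : ℕ} (h : OperatorPlateauAt k) : OrthoPlateauAt k := by
  obtain ⟨C, lam0, hC0, hlam0, hC⟩ := h
  refine ⟨C, lam0, hC0, hlam0, fun lam hlam hle => ?_⟩
  obtain ⟨L0, hL⟩ := hC lam hlam hle
  refine ⟨L0, fun L _ hL0 β hW => ?_⟩
  obtain ⟨φ, hφ, hφ1, hKφ, O, hO, hcl⟩ := hL L hL0 β hW
  exact ⟨φ, hφ, hφ1, hKφ, fun i => ins φ (O i), fun i => isPhys_ins hφ (hO i), fun i => l2_vac_ins hφ (hO i) hφ1, hcl⟩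

omit [NeZero L] in
/-- ★★ **`OperatorPlateauAt k → ExcitedPlateauAt k`** (hence `→ DiagonalPlateauAt k → RitzGeneratorsAt k → DressedRitzAt k`).
[cite: LuscherWolff1990] -/
theorem excitedPlateauAt_of_operatorPlateauAt {k : ℕ} (h : OperatorPlateauAt k) : ExcitedPlateauAt k :=
  excitedPlateauAt_of_orthoPlateauAt (orthoPlateauAt_of_operatorPlateauAt h)

end Reduction

/-! ## §4 Down to the level-`k` slice of item 20205 and to the route decl BY NAME -/

/-- ★ **`OrthoPlateauAt k → DressedRitzAt k`** (through `ExcitedPlateauAt k → DiagonalPlateauAt k → RitzGeneratorsAt k`). [cite: Luscher1983, §3] -/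
theorem dressedRitzAt_of_orthoPlateauAt {k : ℕ} (h : OrthoPlateauAt k) : DressedRitzAt k :=
  dressedRitzAt_of_excitedPlateauAt (excitedPlateauAt_of_orthoPlateauAt h)

/-- ★ **`OperatorPlateauAt k → DressedRitzAt k`** — closing the level-`k` slice of item 20205 = proving `OperatorPlateauAt k`. [cite: LuscherWolff1990] -/
theorem dressedRitzAt_of_operatorPlateauAt {k : ℕ} (h : OperatorPlateauAt k) : DressedRitzAt k :=
  dressedRitzAt_of_excitedPlateauAt (excitedPlateauAt_of_operatorPlateauAt h)

/-- ★★ **`(∀ k, OperatorPlateauAt k) → Theses.LuscherReduction.DressedRitz`** (item stmt-QuantumFields-20205, BY NAME): closing item 20205 =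
proving `OperatorPlateauAt k` for every `k` and applying this theorem. [cite: LuscherWolff1990] -/
theorem dressedRitz_of_operatorPlateau (h : ∀ k : ℕ, OperatorPlateauAt k) :
    Summit.QuantumFields.YangMills.Theses.LuscherReduction.DressedRitz :=
  fun k => dressedRitzAt_of_operatorPlateauAt (h k)

/-- **`(∀ k, OrthoPlateauAt k) → Theses.LuscherReduction.DressedRitz`** (item stmt-QuantumFields-20205, BY NAME). [cite: Luscher1983, §3] -/
theorem dressedRitz_of_orthoPlateau (h : ∀ k : ℕ, OrthoPlateauAt k) :
    Summit.QuantumFields.YangMills.Theses.LuscherReduction.DressedRitz :=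
  fun k => dressedRitzAt_of_orthoPlateauAt (h k)

end Summit.QuantumFields.YangMills.Theorems.FemtoTransferGap.OpPlat

end
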